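import Summits.ValiantsHypothesis.ValiantsHypothesis.Theorems.DualUnipotentThreeHalves.Negative.InflatedReturns

/-!
# val-idea-29 g5 — `invisible-coupling` (crux idea for stmt-ValiantsHypothesis-24318, R2 `HeavyTopLaw`)

First lemmas of the line, over existing declarations (`infl`, `bv`, `J4`, `R2` of
`…Theorems.DualUnipotentThreeHalvesNegative.InflatedReturns`, conventions `J₄ e_a = e_{a-1}`, `R₂ = E₂₀ − E₃₁`).

* `InvisibleCoupling` — the abstract nilpotency lemma behind the construction `E♮(n) = U ⊕ Z ⊕ ℂ·c`.
* `twoStep` — the TWO-STEP KERNEL of the inflation `U₄ₖ`: `X² (e₁ ⊗ x) = 0` for every `X = J₄ ⊗ A + s·R₂ ⊗ 1`.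
* `readSlot_two` — the image `X (e₁ ⊗ x)` has no slot-2 component (the reading covector of `c_out` sees nothing).
Together: `c_out ∘ Xⁱ ∘ c_in = 0` for all `i ≥ 0`, the hypothesis of `InvisibleCoupling`.
VP ≠ VNP is NOT proved here; 24318 / R2 stay OPEN.
-/

open Matrix
open scoped Kronecker

namespace Summit.ValiantsHypothesis.ValiantsHypothesis.Cruxes.DualUnipotentThreeHalves.InvisibleCoupling

open Summit.ValiantsHypothesis.ValiantsHypothesis.Theorems.DualUnipotentThreeHalvesNegative.InflatedReturns

/-- **Invisible-coupling lemma** (abstract form; paper proof = closed-walk expansion of `tr Xᴺ`):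
if `u`, `z` are nilpotent and the coupling `(a, b)` satisfies `b · uⁱ · a = 0` for all `i`, then the block matrix
`[[u, a], [b, z]]` is nilpotent.  Applied elementwise to `W♮ = {u ⊕ z + γ·(c_in, c_out)}` it makes the irreducible
coupled space nilpotent. -/
def InvisibleCoupling : Prop :=
  ∀ (p q : ℕ) (u : Matrix (Fin p) (Fin p) ℂ) (z : Matrix (Fin q) (Fin q) ℂ) (a : Matrix (Fin p) (Fin q) ℂ)
    (b : Matrix (Fin q) (Fin p) ℂ), IsNilpotent u → IsNilpotent z → (∀ i : ℕ, b * u ^ i * a = 0) →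
    IsNilpotent (Matrix.fromBlocks u a b z)


/-- **Lemma IC, kernel-checked** (Proof 2 of the card: with `Y = [[u,a],[0,z]]`, `B = [[0,0],[b,0]]` one has
`B·Yʲ·B = 0`, hence `(Y+B)^N = Y^N + Σ Yⁱ B Y^{N-1-i}`, and `Y^{p'+q'} = 0`). -/
theorem invisibleCoupling_holds : InvisibleCoupling := by
  intro p q u z a b hu hz hba
  obtain ⟨p', hp'⟩ := hu
  obtain ⟨q', hq'⟩ := hz
  set Y : Matrix (Fin p ⊕ Fin q) (Fin p ⊕ Fin q) ℂ := Matrix.fromBlocks u a 0 z with hY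
  set B : Matrix (Fin p ⊕ Fin q) (Fin p ⊕ Fin q) ℂ := Matrix.fromBlocks 0 0 b 0 with hB
  have hX : Matrix.fromBlocks u a b z = Y + B := by
    rw [hY, hB, Matrix.fromBlocks_add]; simp
  -- closed form of the powers of `Y`, with a corner annihilated by `b`
  have key : ∀ j : ℕ, ∃ cj : Matrix (Fin p) (Fin q) ℂ, b * cj = 0 ∧
      Y ^ j = Matrix.fromBlocks (u ^ j) cj 0 (z ^ j) := by
    intro j
    induction j with
    | zero => exact ⟨0, by simp, by simp [Matrix.fromBlocks_one]⟩
    | succ j ih =>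
      obtain ⟨cj, hbcj, hYj⟩ := ih
      refine ⟨u ^ j * a + cj * z, ?_, ?_⟩
      · rw [Matrix.mul_add, ← Matrix.mul_assoc, hba j, ← Matrix.mul_assoc, hbcj]; simp
      · rw [pow_succ, hYj, hY, Matrix.fromBlocks_multiply]
        simp [pow_succ]
  have hBYB : ∀ j : ℕ, B * Y ^ j * B = 0 := by
    intro j
    obtain ⟨cj, hbcj, hYj⟩ := key j
    have hbcjb : b * (cj * b) = 0 := by rw [← Matrix.mul_assoc, hbcj, Matrix.zero_mul]
    rw [hYj, hB, Matrix.fromBlocks_multiply, Matrix.fromBlocks_multiply]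
    simp [hbcj, hbcjb]
  have hYM : Y ^ (p' + q') = 0 := by
    obtain ⟨c1, -, h1⟩ := key p'
    obtain ⟨c2, -, h2⟩ := key q'
    rw [pow_add, h1, h2, hp', hq', Matrix.fromBlocks_multiply]
    simp
  -- words with two `B`s vanish
  have expand : ∀ N : ℕ, (Y + B) ^ N = Y ^ N + ∑ i ∈ Finset.range N, Y ^ i * B * Y ^ (N - 1 - i) := by
    intro N
    induction N with
    | zero => simp
    | succ N ih =>
      have hSB : (∑ i ∈ Finset.range N, Y ^ i * B * Y ^ (N - 1 - i)) * B = 0 := by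
        rw [Finset.sum_mul]
        refine Finset.sum_eq_zero fun i _ => ?_
        rw [mul_assoc (Y ^ i) B, mul_assoc (Y ^ i), hBYB, mul_zero]
      have hSY : (∑ i ∈ Finset.range N, Y ^ i * B * Y ^ (N - 1 - i)) * Y =
          ∑ i ∈ Finset.range N, Y ^ i * B * Y ^ (N - i) := by
        rw [Finset.sum_mul]
        refine Finset.sum_congr rfl fun i hi => ?_
        rw [Finset.mem_range] at hi
        rw [mul_assoc, ← pow_succ, show N - 1 - i + 1 = N - i by omega]
      rw [pow_succ, ih, add_mul, mul_add, mul_add, ← pow_succ, hSB, add_zero, hSY]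
      simp only [Nat.add_sub_cancel]
      rw [Finset.sum_range_succ, Nat.sub_self, pow_zero, mul_one]
      abel
  refine ⟨2 * (p' + q') + 1, ?_⟩
  rw [hX, expand, pow_eq_zero_of_le (by omega) hYM, zero_add]
  refine Finset.sum_eq_zero fun i hi => ?_
  rw [Finset.mem_range] at hi
  by_cases him : p' + q' ≤ i
  · rw [pow_eq_zero_of_le him hYM, zero_mul, zero_mul]
  · rw [pow_eq_zero_of_le (show p' + q' ≤ 2 * (p' + q') + 1 - 1 - i by omega) hYM, mul_zero]

variable (k : ℕ)

/-- One step: `X (e₁ ⊗ x) = e₀ ⊗ Ax − s • e₃ ⊗ x`. -/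
theorem oneStep (A : Matrix (Fin k) (Fin k) ℂ) (s : ℂ) (x : Fin k → ℂ) :
    infl k A s *ᵥ bv k 1 x = bv k 0 (A *ᵥ x) - s • bv k 3 x := by
  simp only [infl, add_mulVec, Matrix.smul_mulVec, JA_bv, R1_bv]
  simp [sub_eq_add_neg]

/-- **Two-step kernel**: `X² (e₁ ⊗ x) = 0` for every `X ∈ U₄ₖ` and every `x`. -/
theorem twoStep (A : Matrix (Fin k) (Fin k) ℂ) (s : ℂ) (x : Fin k → ℂ) :
    infl k A s *ᵥ (infl k A s *ᵥ bv k 1 x) = 0 := by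
  rw [oneStep, mulVec_sub, mulVec_smul]
  simp only [infl, add_mulVec, Matrix.smul_mulVec, JA_bv, R1_bv]
  simp

/-- The reading slot is blind: slot `2` of `e₁ ⊗ x` and of `X (e₁ ⊗ x)` vanishes. -/
theorem readSlot_two (A : Matrix (Fin k) (Fin k) ℂ) (s : ℂ) (x : Fin k → ℂ) (i : Fin k) :
    bv k 1 x (2, i) = 0 ∧ (infl k A s *ᵥ bv k 1 x) (2, i) = 0 := by
  refine ⟨by simp [bv], ?_⟩
  rw [oneStep]
  simp [bv]

end Summit.ValiantsHypothesis.ValiantsHypothesis.Cruxes.DualUnipotentThreeHalves.InvisibleCoupling
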